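import Summits.Ventures.YMGap.Census.WindowTwist
import Summits.Ventures.YMGap.Census.PotentialMovingTwist
import HarnessLib

/-!
# Venture YMGap, track (b) census — Tomboulis's twisted decimation bound (UAtwist) at `r = 1` on the positivity domain
# (arXiv:0707.2179, App. A §4, the twisted analogue of (A.19), the input of Prop. IV.3 (4.12))

HONEST FRAMING: venture file of the cell `pub-ymgap` (QuantumFields programme), track (b) census.  Exact statement about the
finite tori `(ℤ/bLℤ)^d → (ℤ/Lℤ)^d` (`L ≥ 2`) with Tomboulis's vortex sheet `𝒱_{ij}` on both; nothing about (5.15), confinement or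
any limit.  KERNEL:

  `twistedDecimationUpperBound_of_nonneg : Z⁻_{(ℤ/bL)^d}({c_j}; 𝒱_{ij}) ≤ F₀^U(1)^{|Λ^{(1)}|} · Z⁻_{(ℤ/L)^d}({c^U_j(1,1)}; 𝒱_{ij})`

for every `d`, `b ≥ 1`, `L ≥ 2`, `J`, `i < j`, every admissible `c` with `f_c ≥ 0` — the twisted companion of
`decimationUpperBound_of_nonneg` (same `F₀^U`, same `c^U_j(1,1) = mkCoeff J c (b^{d-2}) b 1`).  Assembly of
`torusZtw_fine_le_tPowFieldZ_mkExp` (twisted potential moving), the identification of the moved twisted integrand with the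
flagged windows of `WindowTwist` (the surviving sheet plaquette of the window of `P ∈ 𝒱` is its corner face `(0,0)`, whose sign is
the corner-link flip: `hol_flipAt_base`), `integral_prod_tWindowProd_eq_prod_tMergedFace` (exact integration), `coarseWord_flipAt`
(the flipped merged window is the coarse twisted plaquette function) and the coarse-graining substitution `integral_comp_cwConfig`.
[cite: Tomboulis2007Confinement, App. A §4 (UAtwist); Prop. IV.3 eq. (4.12)]
-/

noncomputable section

open MeasureTheory Finset Real Function
open scoped BigOperators
open Literature.MathematicalPhysics.QuantumLattice
open Literature.MathematicalPhysics.QuantumFieldTheory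
open Literature.MathematicalPhysics.QuantumFieldTheory.Tomboulis2007
open Literature.MathematicalPhysics.QuantumFieldTheory.WilsonRP
open Summit.Ventures.LatticeQCDFlow.Exactness
open Summit.Ventures.LatticeQCDFlow.Scoring

namespace Summit.Ventures.YMGap.Census

variable {d L : ℕ} {b : ℕ} [NeZero b] [NeZero L]

/-! ### Geometry of the corner flip -/

omit [NeZero b] [NeZero L] in
/-- Inside the window, `h_{s,t} = h_{0,0}` iff `(s,t) = (0,0)`. -/
theorem hLink_eq_corner_iff (P : Plaquette d L) {s t : ℕ} (hs : s < b) (ht : t < b) :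
    hLink b P s t = hLink b P 0 0 ↔ s = 0 ∧ t = 0 := by
  constructor
  · intro h
    by_contra hne
    rcases not_and_or.1 hne with hs0 | ht0
    · exact hLink_ne_hLink_of_fst_mod_ne P t 0 (by rw [Nat.mod_eq_of_lt hs, Nat.zero_mod]; exact hs0) h
    · exact hLink_ne_hLink_of_mod_ne P s 0 (by rw [Nat.mod_eq_of_lt ht, Nat.zero_mod]; exact ht0) h
  · rintro ⟨rfl, rfl⟩; rfl

/-- On a coarse torus of side `≥ 2` the top row of the window is not its bottom row: `h_{s,b} ≠ h_{0,0}`. -/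
theorem hLink_top_ne_corner [Fact (1 < L)] (P : Plaquette d L) {s : ℕ} (hs : s < b) : hLink b P s b ≠ hLink b P 0 0 := by
  rw [hLink_top, hLink_zero]
  intro h
  have h1 := (cLink_inj hs (Nat.pos_of_ne_zero (NeZero.ne b)) h).1
  have h2 := congrFun (congrArg Prod.fst h1) P.2.1.2
  simp [Site.shift] at h2

/-- **The corner flip on the faces of the window**: the holonomy of the face `(s,t)` picks up `-𝟙` iff `(s,t) = (0,0)`. -/
theorem hol_flipAt_base [Fact (1 < L)] (P : Plaquette d L) {s t : ℕ} (hs : s < b) (ht : t < b) (W : GaugeConfig d (b * L) SU2) :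
    plaquetteHolonomy (flipAt b P W) (base b P s t) P.2.1.1 P.2.1.2 =
      (if s = 0 ∧ t = 0 then negOne else 1) * plaquetteHolonomy W (base b P s t) P.2.1.1 P.2.1.2 := by
  rw [plaquetteHolonomy_base, plaquetteHolonomy_base]
  unfold flipAt
  have hv1 : update W (hLink b P 0 0) (negOne * W (hLink b P 0 0)) (vLink b P (s + 1) t) = W (vLink b P (s + 1) t) :=
    update_of_ne (hLink_ne_vLink P 0 0 (s + 1) t).symm _ _
  have hv0 : update W (hLink b P 0 0) (negOne * W (hLink b P 0 0)) (vLink b P s t) = W (vLink b P s t) :=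
    update_of_ne (hLink_ne_vLink P 0 0 s t).symm _ _
  have hh1 : update W (hLink b P 0 0) (negOne * W (hLink b P 0 0)) (hLink b P s (t + 1)) = W (hLink b P s (t + 1)) := by
    refine update_of_ne ?_ _ _
    by_cases htb : t + 1 < b
    · exact fun h => absurd ((hLink_eq_corner_iff P hs htb).1 h).2 (Nat.succ_ne_zero t)
    · have hb : t + 1 = b := by omega
      rw [hb]
      exact hLink_top_ne_corner P hs
  rw [hv1, hv0, hh1]
  by_cases h0 : s = 0 ∧ t = 0
  · obtain ⟨rfl, rfl⟩ := h0
    rw [update_self, if_pos ⟨rfl, rfl⟩]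
    simp only [mul_assoc]
  · rw [update_of_ne (fun h => h0 ((hLink_eq_corner_iff P hs ht).1 h)), if_neg h0, one_mul]

omit [NeZero b] [NeZero L] in
/-- `Σ_m A_m χ_m(-g) = Σ_m (-1)^m A_m χ_m(g)`. -/
theorem faceSum_negOne_mul (K : ℕ) (A : ℕ → ℝ) (g : SU2) : faceSum K A (negOne * g) = faceSum K (twistVec A) g := by
  show ∑ n ∈ Finset.range (K + 1), A n * su2Char n (negOne * g) = ∑ n ∈ Finset.range (K + 1), twistVec A n * su2Char n g
  exact Finset.sum_congr rfl fun n _ => by rw [su2Char_negOne_mul, twistVec]; ring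

omit [NeZero b] [NeZero L] in
/-- A character sum of `Re tr U_p` is the face sum of the holonomy (general coefficient vector). -/
theorem charSum_plaqRe_eq_faceSum (K : ℕ) (B : ℕ → ℝ) (W : GaugeConfig d L SU2) (p : Plaquette d L) :
    charSum K B (plaqRe rhoFund W p) = faceSum K B (plaquetteHolonomy W p.1 p.2.1.1 p.2.1.2) := by
  unfold charSum faceSum
  simp only [charR_plaqRe]

/-- **The surviving sheet plaquettes are the corner faces of the windows of the coarse sheet**: the fine face `(s,t)` of the window
of `P` lies on `𝒱_{ij}` of the fine torus iff `P ∈ 𝒱_{ij}` of the coarse torus and `(s,t) = (0,0)`. -/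
theorem finePlaq_mem_vortexSheet_iff {i j : Fin d} (hij : i < j) (P : Plaquette d L) {s t : ℕ} (hs : s < b) (ht : t < b) :
    finePlaq b P s t ∈ vortexSheet (b * L) i j hij ↔ P ∈ vortexSheet L i j hij ∧ s = 0 ∧ t = 0 := by
  rw [vortexSheet_eq_sheetAt, vortexSheet_eq_sheetAt, mem_sheetAt, mem_sheetAt]
  constructor
  · rintro ⟨h2, hi, hj⟩
    have h2' : P.2 = ⟨(i, j), hij⟩ := h2
    have hi' : P.2.1.1 = i := by rw [h2']
    have hj' : P.2.1.2 = j := by rw [h2']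
    have hi2 : base b P s t P.2.1.1 = 0 := by rw [hi']; exact hi
    have hj2 : base b P s t P.2.1.2 = 0 := by rw [hj']; exact hj
    rw [base_apply_fst] at hi2
    rw [base_apply_snd] at hj2
    have hs' := (scale_eq_scale_add_natCast_iff (b := b) (L := L) (w := 0) (w' := P.1 P.2.1.1) hs).1 (by rw [scale_zero, hi2])
    have ht' := (scale_eq_scale_add_natCast_iff (b := b) (L := L) (w := 0) (w' := P.1 P.2.1.2) ht).1 (by rw [scale_zero, hj2])
    exact ⟨⟨h2', by rw [← hi', ← hs'.1], by rw [← hj', ← ht'.1]⟩, hs'.2, ht'.2⟩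
  · rintro ⟨⟨h2, hi, hj⟩, rfl, rfl⟩
    have hi' : P.2.1.1 = i := by rw [h2]
    have hj' : P.2.1.2 = j := by rw [h2]
    refine ⟨h2, ?_, ?_⟩
    · show base b P 0 0 i = 0
      rw [← hi', base_apply_fst, hi', hi, scale_zero, Nat.cast_zero, add_zero]
    · show base b P 0 0 j = 0
      rw [← hj', base_apply_snd, hj', hj, scale_zero, Nat.cast_zero, add_zero]

/-! ### The moved twisted integrand is the product of the flagged windows -/

variable (b) in
/-- The twisted window integrand: the corner face of the window of every `P ∈ Vc` carries the twisted coefficient vector. -/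
def tWindowFn (K : ℕ) (A : ℕ → ℝ) (Vc : Finset (Plaquette d L)) (W : GaugeConfig d (b * L) SU2) : ℝ :=
  ∏ x : Plaquette d L × (Fin b × Fin b),
    faceSum K (if x.1 ∈ Vc ∧ (x.2.1 : ℕ) = 0 ∧ (x.2.2 : ℕ) = 0 then twistVec A else A)
      (plaquetteHolonomy W (base b x.1 x.2.1 x.2.2) x.1.2.1.1 x.1.2.1.2)

/-- **The moved twisted integrand is `F̂₀^{b²·#Plaq}` times the twisted window integrand** (as `powFieldFn_mkExp_eq`, with the
twist of `𝒱` landing on the corner faces of the windows of the coarse `𝒱`). -/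
theorem tPowFieldFn_mkExp_eq (J : ℕ) {c : ℕ → ℝ} (hc : ∀ n, 1 ≤ n → 0 ≤ c n) (ζ : ℕ) {i j : Fin d} (hij : i < j)
    (W : GaugeConfig d (b * L) SU2) :
    tPowFieldFn J c (vortexSheet (b * L) i j hij) (fun q : Plaquette d (b * L) => if ∀ κ ∈ perpDirs q, resb b L (q.1 κ) = 0 then ζ else 0) W =
      mkFhat J c ζ 0 ^ (Fintype.card (Plaquette d L) * b ^ 2) * tWindowFn b (ζ * J) (stdCoef (hatCoeff J c ζ)) (vortexSheet L i j hij) W := by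
  unfold tPowFieldFn tWindowFn
  rw [prod_pow_mkExp_eq_prod_window (fun q => twR J c (vortexSheet (b * L) i j hij) q (plaqRe rhoFund W q)) ζ]
  have hx : ∀ x : Plaquette d L × (Fin b × Fin b),
      twR J c (vortexSheet (b * L) i j hij) (windowMap b x) (plaqRe rhoFund W (windowMap b x)) ^ ζ =
        mkFhat J c ζ 0 * faceSum (ζ * J) (if x.1 ∈ vortexSheet L i j hij ∧ (x.2.1 : ℕ) = 0 ∧ (x.2.2 : ℕ) = 0
          then twistVec (stdCoef (hatCoeff J c ζ)) else stdCoef (hatCoeff J c ζ))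
          (plaquetteHolonomy W (base b x.1 x.2.1 x.2.2) x.1.2.1.1 x.1.2.1.2) := by
    intro x
    have hmem : windowMap b x ∈ vortexSheet (b * L) i j hij ↔ x.1 ∈ vortexSheet L i j hij ∧ (x.2.1 : ℕ) = 0 ∧ (x.2.2 : ℕ) = 0 :=
      finePlaq_mem_vortexSheet_iff hij x.1 x.2.1.isLt x.2.2.isLt
    unfold twR
    by_cases h : x.1 ∈ vortexSheet L i j hij ∧ (x.2.1 : ℕ) = 0 ∧ (x.2.2 : ℕ) = 0
    · rw [if_pos (hmem.2 h), if_pos h, ← charSum_neg, charSum_stdCoef, fR_pow_eq_mkFhat_mul_fR hc ζ, ← charSum_stdCoef,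
        charSum_neg, charSum_plaqRe_eq_faceSum]
      rfl
    · rw [if_neg (fun h' => h (hmem.1 h')), if_neg h, charSum_stdCoef, fR_pow_eq_mkFhat_mul_fR hc ζ, fR_eq_faceSum]
      rfl
  simp only [hx]
  rw [Finset.prod_mul_distrib, Finset.prod_const, Finset.card_univ, card_window]

omit [NeZero b] [NeZero L] in
/-- The plain window product as a product over the `Fin b × Fin b` faces (as in `windowFn_eq_prod_windowProd`). -/
theorem prod_fin_faceSum_eq_windowProd (K : ℕ) (A : ℕ → ℝ) (P : Plaquette d L) (W : GaugeConfig d (b * L) SU2) :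
    ∏ st : Fin b × Fin b, faceSum K A (plaquetteHolonomy W (base b P st.1 st.2) P.2.1.1 P.2.1.2) = windowProd b K A P W := by
  unfold windowProd rowProd
  rw [Fintype.prod_prod_type]
  simp_rw [← faceSum_base_eq_faceW]
  rw [Finset.prod_comm]
  rw [← Fin.prod_univ_eq_prod_range (fun t => ∏ s ∈ Finset.range b,
    faceSum K A (plaquetteHolonomy W (base b P s t) P.2.1.1 P.2.1.2)) b]
  refine Finset.prod_congr rfl fun t _ => ?_
  exact (Fin.prod_univ_eq_prod_range (fun s => faceSum K A (plaquetteHolonomy W (base b P s t) P.2.1.1 P.2.1.2)) b)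

/-- **The flagged window product is the window product with the corner face twisted.** -/
theorem prod_fin_faceSum_twist_eq_tWindowProd [Fact (1 < L)] (K : ℕ) (A : ℕ → ℝ) (Vc : Finset (Plaquette d L)) (P : Plaquette d L)
    (W : GaugeConfig d (b * L) SU2) :
    ∏ st : Fin b × Fin b, faceSum K (if P ∈ Vc ∧ (st.1 : ℕ) = 0 ∧ (st.2 : ℕ) = 0 then twistVec A else A)
        (plaquetteHolonomy W (base b P st.1 st.2) P.2.1.1 P.2.1.2) = tWindowProd b K A Vc P W := by
  unfold tWindowProd
  by_cases hP : P ∈ Vc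
  · rw [if_pos hP, ← prod_fin_faceSum_eq_windowProd]
    refine Finset.prod_congr rfl fun st _ => ?_
    rw [hol_flipAt_base P st.1.isLt st.2.isLt]
    by_cases h0 : (st.1 : ℕ) = 0 ∧ (st.2 : ℕ) = 0
    · rw [if_pos ⟨hP, h0⟩, if_pos h0, faceSum_negOne_mul]
    · rw [if_neg (fun h => h0 h.2), if_neg h0, one_mul]
  · rw [if_neg hP, ← prod_fin_faceSum_eq_windowProd]
    refine Finset.prod_congr rfl fun st _ => ?_
    rw [if_neg (fun h => hP h.1)]

/-- `tWindowFn = ∏_P tWindowProd_P`. -/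
theorem tWindowFn_eq_prod_tWindowProd [Fact (1 < L)] (K : ℕ) (A : ℕ → ℝ) (Vc : Finset (Plaquette d L)) (W : GaugeConfig d (b * L) SU2) :
    tWindowFn b K A Vc W = ∏ P : Plaquette d L, tWindowProd b K A Vc P W := by
  unfold tWindowFn
  rw [Fintype.prod_prod_type]
  exact Finset.prod_congr rfl fun P _ => prod_fin_faceSum_twist_eq_tWindowProd K A Vc P W

/-! ### The flagged merged window is the twisted coarse plaquette function -/

/-- **The corner flip multiplies the boundary word of the window by `-𝟙`.** -/
theorem coarseWord_flipAt [Fact (1 < L)] (P : Plaquette d L) (W : GaugeConfig d (b * L) SU2) :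
    coarseWord b P (flipAt b P W) = negOne * coarseWord b P W := by
  have hb : 1 ≤ b := Nat.one_le_iff_ne_zero.2 (NeZero.ne b)
  have h1 : ∀ W' : GaugeConfig d (b * L) SU2, hRow b P 0 W' = cw b (P.1, P.2.1.1) W' := fun W' => by
    unfold hRow cw rowA; simp only [hLink_zero]
  have hH0 : hRow b P 0 (flipAt b P W) = negOne * hRow b P 0 W := by
    rw [h1, h1]
    unfold flipAt
    rw [hLink_zero, cw_eq_head_mul, cw_eq_head_mul, update_self, cwRest_update_head, mul_assoc]
  have hHb : hRow b P b (flipAt b P W) = hRow b P b W := by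
    unfold flipAt hRow
    exact prodA_update_le (fun s hs U g => by unfold rowA; exact update_of_ne (hLink_top_ne_corner P (by omega)) _ _) W _
  have hV : ∀ s', vCol b P s' (flipAt b P W) = vCol b P s' W := fun s' => by
    unfold flipAt vCol
    exact prodA_update_le (fun t _ U g => update_of_ne (hLink_ne_vLink P 0 0 s' t).symm _ _) W _
  unfold coarseWord
  rw [hH0, hHb, hV, hV]
  simp only [mul_assoc]

/-- The twisted coarse torus integrand `∏_P Σ_m (±1)^m A_m χ_m(V_P)`, sign `-` on `Vc`. -/
def torusFnTw (K : ℕ) (A : ℕ → ℝ) (Vc : Finset (Plaquette d L)) (V : GaugeConfig d L SU2) : ℝ :=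
  ∏ P : Plaquette d L, faceSum K (if P ∈ Vc then twistVec A else A) (plaquetteHolonomy V P.1 P.2.1.1 P.2.1.2)

/-- **The product of the flagged merged windows is the twisted coarse integrand read through the coarse-graining map.** -/
theorem prod_tMergedFace_eq_torusFnTw [Fact (1 < L)] (K : ℕ) (A : ℕ → ℝ) (Vc : Finset (Plaquette d L)) (W : GaugeConfig d (b * L) SU2) :
    ∏ P : Plaquette d L, tMergedFace b K A Vc P W = torusFnTw K (cellCoef b A) Vc (cwConfig b W) := by
  unfold torusFnTw tMergedFace mergedFace
  refine Finset.prod_congr rfl fun P _ => ?_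
  by_cases hP : P ∈ Vc
  · rw [if_pos hP, if_pos hP, coarseWord_flipAt, faceSum_negOne_mul, coarseWord_eq_holonomy]
  · rw [if_neg hP, if_neg hP, coarseWord_eq_holonomy]

omit [NeZero b] in
/-- `torusFnTw` is continuous. -/
theorem continuous_torusFnTw (K : ℕ) (A : ℕ → ℝ) (Vc : Finset (Plaquette d L)) : Continuous (torusFnTw (d := d) (L := L) K A Vc) := by
  unfold torusFnTw
  refine continuous_finsetProd _ fun P _ => (continuous_faceSum K _).comp ?_
  unfold plaquetteHolonomy
  fun_prop

omit [NeZero b] in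
/-- The twisted coarse integrand of `stdCoef c'` integrates to `Z⁻_{(ℤ/L)^d}({c'_j}; Vc)`. -/
theorem integral_torusFnTw_stdCoef (K : ℕ) (c' : ℕ → ℝ) (Vc : Finset (Plaquette d L)) :
    ∫ V, torusFnTw K (stdCoef c') Vc V ∂(Measure.pi fun _ : Edge d L => haarProbability SU2) = torusZtw d L K c' Vc := by
  unfold torusFnTw torusZtw
  refine integral_congr_ae (ae_of_all _ fun V => Finset.prod_congr rfl fun P _ => ?_)
  by_cases hP : P ∈ Vc
  · rw [if_pos hP, if_pos hP, ← charSum_plaqRe_eq_faceSum, charSum_twistVec_stdCoef]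
  · rw [if_neg hP, if_neg hP, plaqFn_hol_eq_fR, fR_eq_faceSum]

/-! ### Assembly -/

/-- **Tomboulis's twisted decimation bound (arXiv:0707.2179 App. A §4, (UAtwist)) at `r = 1` on the positivity domain.**
One potential-moving decimation `(ℤ/bLℤ)^d → (ℤ/Lℤ)^d` (`ζ = b^{d-2}`, `L ≥ 2`) bounds the TWISTED partition function above, with
the same bulk factor and the same decimated coefficients as `decimationUpperBound_of_nonneg`, the twist staying on Tomboulis's sheet
`𝒱_{ij}`: `Z⁻_{(ℤ/bL)^d}({c_j}) ≤ F₀^U(1)^{|Λ^{(1)}|} · Z⁻_{(ℤ/L)^d}({c^U_j(1,1)})` for admissible `c` with `f_c ≥ 0` on `SU(2)`. -/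
theorem twistedDecimationUpperBound_of_nonneg [Fact (1 < L)] {i j : Fin d} (hij : i < j) (J : ℕ) {c : ℕ → ℝ}
    (hc : CoeffAdmissible c) (hf : ∀ g : SU2, 0 ≤ plaqFn J c g) :
    torusZtw d (b * L) J c (vortexSheet (b * L) i j hij) ≤
      mkF0 J c (b ^ (d - 2)) b ^ Fintype.card (Plaquette d L) *
        torusZtw d L (b ^ (d - 2) * J) (mkCoeff J c (b ^ (d - 2)) b 1) (vortexSheet L i j hij) := by
  have hc' : ∀ n, 1 ≤ n → 0 ≤ c n := fun n hn => (hc n hn).1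
  -- the inequality: twisted potential moving
  refine (torusZtw_fine_le_tPowFieldZ_mkExp b J hf hij).trans (le_of_eq ?_)
  -- the exact integrations
  unfold tPowFieldZ
  simp_rw [tPowFieldFn_mkExp_eq J hc' (b ^ (d - 2)) hij, tWindowFn_eq_prod_tWindowProd]
  rw [integral_const_mul, integral_prod_tWindowProd_eq_prod_tMergedFace]
  have hco : mkCoeff J c (b ^ (d - 2)) b 1 = fun n => hatCoeff J c (b ^ (d - 2)) n ^ (b ^ 2) :=
    funext fun n => mkCoeff_one_eq_pow J c _ b n
  simp_rw [prod_tMergedFace_eq_torusFnTw, cellCoef_stdCoef]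
  rw [integral_comp_cwConfig (continuous_torusFnTw _ _ _), integral_torusFnTw_stdCoef, hco]
  unfold mkF0
  rw [← pow_mul, mul_comm (b ^ 2)]

end Summit.Ventures.YMGap.Census

end
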